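import Literature.AlgebraicGeometry.Resolution.AbhyankarConstantReduction
import Literature.AlgebraicGeometry.Resolution.AbhyankarToroidalCharts
import Literature.AlgebraicGeometry.Resolution.PurelyInseparableBaseChange
import Mathlib.FieldTheory.IsAlgClosed.AlgebraicClosure
import HarnessLib

/-!
# Residual separability after a purely inseparable extension of the constants
# (Temkin 2013, Thm. 5.5.3, from the generalized stability theorem)

Topic: `Literature/AlgebraicGeometry/Resolution` (valued function fields). This file PROVES

* `Temkin2013_Thm553.of_stability : Kuhlmann2010Stability → Temkin2013_Thm553`,

i.e. M. Temkin, *Inseparable local uniformization*, J. Algebra 373 (2013) 65–119 =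
arXiv:0804.1554v3, **Thm. 5.5.3** (p. 61: "If `K` is a finitely generated Abhyankar valued field
over `k` then there exists a finite purely inseparable extension `l/k` such that for any finite
purely inseparable extension `l'/l` the field `l̃'K` is separable over `l'`"), as vendored in
`AbhyankarToroidalCharts.lean`, from the single named fact `Kuhlmann2010Stability`
(`ValuationDefect.lean`) — the generalized stability theorem [Kuh, Thm. 1.1] over a trivially valued
ground field, which is exactly the "rather deep fact" the printed proof rests on (Remark 2.1.3 and
p. 61: "Since `L̄` is an Abhyankar field over `k̄`, it is stable and the stability allows us to
control the extension `K̄/L̄` in terms of the valuation groups and the residue fields"). The frontier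
of `Temkin2013_Thm553` thereby becomes that of `Kuhlmann2010Stability`
(`{FundamentalInequality, Kuhlmann2010StabilityRational}`, `GeneralizedStability.lean`).

## Proof (continuing `AbhyankarConstantReduction.lean`)

Work inside an algebraic closure `Ω` of `K` with an extension `V` of `K°` (Chevalley), an
Abhyankar basis `B = (x, y)` of `K/k` (`AbhyankarInvariants.lean`), generators `T` of `K/k`, and
the levels `L_S = k(S, B) ⊆ M_S = K(S)`, `S ⊆ P = k^{1/p^∞} ∩ Ω`. By the counting theorem
(`exists_inertiaDegree_level_eq`) the inertia degree `f_S = [M̃_S : L̃_S]` is, for all large `S`,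
the one `f̄` at level `P`. The residue field `M̃_P` is finitely generated over the image `P̃` of the
PERFECT field `P`, hence separably generated: `M̃_P = P̃(s)(θ)` with `s` a transcendence basis and
`θ` separable over `P̃(s)` (Mathlib's `exists_isTranscendenceBasis_and_isSeparable_of_perfectField`
through `exists_finset_separatingTranscendenceBasis`, `SeparatingTranscendenceBasis.lean`, applied
to the perfect residue field `Ṽ`). Descending the finitely many constants involved, for large `S`
the field `F⁰ = S̃(s)(θ) ⊆ M̃_S` (`S̃ = k(S)~ ≅ k(S)`) has `[F⁰ : L̃_S] ≥ f̄ = [M̃_S : L̃_S]`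
(`relfinrank_le_relfinrank_of_span`), so `M̃_S = F⁰` is separably generated over `S̃`
(`exists_separablyGenerated_level`). Finally the abstract data of `Temkin2013_Thm553` — `l' ⊇ l`,
the compositum `K' = l'K`, its valuation ring `O'` over `K°` — are realised inside `(Ω, V)`
(`l' ↪ P` uniquely, `K' ↪ Ω` over `K`, `O' = V ∩ K'` by purely inseparable uniqueness,
`K̃' ≅ M̃_S` for `S` the image of `l'`) and the statement is transported.

## Source and deviation

M. Temkin, arXiv:0804.1554v3, Thm. 5.5.3 and its proof (p. 61). As explained in
`AbhyankarConstantReduction.lean`, the degree-`p` tower and the Sylow reduction of the printed proof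
are replaced by a direct comparison of the defect formulas at the levels `S` and `P`; the
stability theorem enters exactly as in the source. [cite: Temkin2013, Thm. 5.5.3 (p. 61 of arXiv:0804.1554v3)]
-/

noncomputable section

namespace Literature.AlgebraicGeometry.Resolution

open IsLocalRing ValuationSubring IntermediateField

universe u

variable {k Ω : Type u} [Field k] [Field Ω] [Algebra k Ω]

/-! ### Residue fields of valuation rings of a perfect field containing a field -/

section Perfect

variable (V : ValuationSubring Ω)

/-- **The residue field of a valuation ring of a perfect field (of equal characteristic) is
perfect**: `p`-th roots exist in `Ω`, lie in `V` when their `p`-th power does, and reduce to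
`p`-th roots. (`k ⊆ V` is any subfield, fixing the characteristic of the residue field.)
[folklore] -/
theorem perfectField_residueField [PerfectField Ω] (hk : ∀ c : k, algebraMap k Ω c ∈ V) :
    PerfectField (ResidueField V) := by
  letI := algebraOfMem k V hk
  obtain ⟨q, hq⟩ := ExpChar.exists k
  haveI : ExpChar Ω q := expChar_of_injective_algebraMap (algebraMap k Ω).injective q
  haveI : ExpChar (ResidueField V) q :=
    expChar_of_injective_ringHom (algebraMap k (ResidueField V)).injective q
  haveI : PerfectRing (ResidueField V) q := by
    refine PerfectRing.ofSurjective _ q fun r => ?_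
    obtain ⟨a, rfl⟩ := residue_surjective r
    obtain ⟨b, hb⟩ := surjective_frobenius Ω q (a : Ω)
    rw [frobenius_def] at hb
    have hbV : b ∈ V := by
      rw [mem_valuationSubring_iff_pow_mem V b (expChar_pos Ω q).ne', hb]
      exact a.2
    refine ⟨residue V ⟨b, hbV⟩, ?_⟩
    rw [frobenius_def, ← map_pow]
    congr 1
    exact Subtype.ext hb
  exact PerfectRing.toPerfectField _ q

/-- **Residues of the perfect closure**: an element of the residue field lying in the relative
perfect closure of `k` is the residue of an element of `P = k^{1/p^∞} ∩ Ω` (take the `pⁿ`-th root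
in the perfect field `Ω` of the constant it is a `pⁿ`-th root of). [folklore] -/
theorem exists_residue_eq_of_mem_perfectClosure [PerfectField Ω] (hk : ∀ c : k, algebraMap k Ω c ∈ V)
    {r : ResidueField V} (hr : letI := algebraOfMem k V hk; r ∈ perfectClosure k (ResidueField V)) :
    ∃ b ∈ perfectClosure k Ω, ∃ hb : b ∈ V, residue V ⟨b, hb⟩ = r := by
  letI := algebraOfMem k V hk
  obtain ⟨q, hq⟩ := ExpChar.exists k
  haveI : ExpChar Ω q := expChar_of_injective_algebraMap (algebraMap k Ω).injective q
  haveI : ExpChar (ResidueField V) q :=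
    expChar_of_injective_ringHom (algebraMap k (ResidueField V)).injective q
  obtain ⟨n, c, hc⟩ := (mem_perfectClosure_iff_pow_mem q).mp hr
  obtain ⟨b, hb⟩ := (bijective_iterateFrobenius Ω q n).2 (algebraMap k Ω c)
  rw [iterateFrobenius_def] at hb
  have hbV : b ∈ V := by
    rw [mem_valuationSubring_iff_pow_mem V b (expChar_pow_pos Ω q n).ne', hb]
    exact hk c
  have hbP : b ∈ perfectClosure k Ω := (mem_perfectClosure_iff_pow_mem q).mpr ⟨n, c, hb.symm⟩
  refine ⟨b, hbP, hbV, ?_⟩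
  -- both residues are `pⁿ`-th roots of the residue of `c`
  haveI : PerfectRing (ResidueField V) q :=
    @PerfectField.toPerfectRing _ _ (perfectField_residueField V hk) q _
  apply (bijective_iterateFrobenius (ResidueField V) q n).1
  rw [iterateFrobenius_def, iterateFrobenius_def, ← hc, ← map_pow]
  change residue V (⟨b, hbV⟩ ^ q ^ n) = residue V (algebraMap k V c)
  congr 1
  exact Subtype.ext hb

/-- The residue of an element of `V` algebraic over `k` is algebraic over `k`. [folklore] -/
theorem isAlgebraic_residue (hk : ∀ c : k, algebraMap k Ω c ∈ V) {a : V}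
    (ha : IsAlgebraic k (a : Ω)) :
    letI := algebraOfMem k V hk
    IsAlgebraic k (residue V a) := by
  letI := algebraOfMem k V hk
  haveI := isScalarTower_algebraOfMem k V hk
  have h1 : IsIntegral k a :=
    (isIntegral_algHom_iff (IsScalarTower.toAlgHom k V Ω) Subtype.val_injective).mp ha.isIntegral
  exact (h1.map (IsScalarTower.toAlgHom k V (ResidueField V))).isAlgebraic

end Perfect

/-! ### Separable generation of the residue field at large levels -/

section SepGen

variable {V : ValuationSubring Ω} {hk : ∀ c : k, algebraMap k Ω c ∈ V} {E F : ℕ} {x : Fin E → Ω}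
  {y : Fin F → Ω} {T : Finset Ω}

/-- The residues of the constants `l_S = k(S)` (`S ⊆ P`) are algebraic over `k`. [folklore] -/
theorem isAlgebraic_resField_lS (hk : ∀ c : k, algebraMap k Ω c ∈ V) {S : Set Ω}
    (hS : S ⊆ PSet k Ω) {r : ResidueField V} (hr : r ∈ resField V (lS k S).toSubfield) :
    letI := algebraOfMem k V hk
    IsAlgebraic k r := by
  letI := algebraOfMem k V hk
  obtain ⟨a, ha, rfl⟩ := (mem_resField_iff V _ r).mp hr
  haveI := isAlgebraic_lS (k := k) hS
  have h1 : IsAlgebraic k (⟨(a : Ω), ha⟩ : lS k S) := Algebra.IsAlgebraic.isAlgebraic _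
  exact isAlgebraic_residue V hk (IntermediateField.isAlgebraic_iff.mp h1)

/-- **Separable generation at large levels** (Temkin 2013, Thm. 5.5.3, in ambient form): if
`Kuhlmann2010Stability` holds, then for all sufficiently large `S ⊆ P` the residue field `M̃_S` of
`M_S = k(S, B, T)` is separably generated over the residue field `S̃` of the constants `k(S)`: there
is a finite `s ⊆ M̃_S`, algebraically independent over `S̃`, with every element of `M̃_S` separable
over `S̃(s)`. (Here `Ω` is perfect, `V ⊇ k` is a valuation ring of `Ω` with Abhyankar system
`(x, y)`, and `T` is integral over `k(B)`.) [cite: Temkin2013, Thm. 5.5.3 (p. 61 of arXiv:0804.1554v3)] -/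
theorem exists_separablyGenerated_level [PerfectField Ω] (hKS : Kuhlmann2010Stability.{u})
    (hB : IsAmbientAbhyankarSystem V hk x y) (hT : ∀ t ∈ T, IsIntegral (levL k x y (∅ : Set Ω)) t) :
    ∃ C : Finset Ω, ↑C ⊆ PSet k Ω ∧ ∀ S : Set Ω, ↑C ⊆ S → S ⊆ PSet k Ω →
      ∃ s : Finset (ResidueField V),
        (s : Set (ResidueField V)) ⊆ (resField V (Mk k x y T S).toSubfield : Set (ResidueField V)) ∧
        AlgebraicIndependent (resField V (lS k S).toSubfield) ((↑) : s → ResidueField V) ∧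
        ∀ z ∈ resField V (Mk k x y T S).toSubfield,
          IsSeparable (IntermediateField.adjoin (resField V (lS k S).toSubfield)
            (s : Set (ResidueField V))) z := by
  classical
  letI ik := algebraOfMem k V hk
  haveI := isScalarTower_algebraOfMem k V hk
  haveI : PerfectField (ResidueField V) := perfectField_residueField V hk
  have hPP : PSet k Ω ⊆ PSet k Ω := subset_rfl
  -- the counting threshold
  obtain ⟨C₁, hC₁P, hC₁⟩ := exists_inertiaDegree_level_eq (T := T) hKS hB hT
  -- residue data at level `P`
  set AP := resField V (Lk k x y (PSet k Ω)).toSubfield with hAP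
  set RP := resField V (Mk k x y T (PSet k Ω)).toSubfield with hRP
  have hAPRP : AP ≤ RP := resField_mono V (Lk_le_Mk (T := T) (PSet k Ω))
  haveI := finiteDimensional_levM (isIntegral_levL_of_empty hT (PSet k Ω))
  have hfbar : 0 < AP.relfinrank RP := by
    rw [hAP, hRP, ← inertiaDegree_level_eq_relfinrank]
    exact (one_le_ramificationIndex_and_inertiaDegree (levL k x y (PSet k Ω))
      (V.comap (algebraMap (levM k x y T (PSet k Ω)) Ω))).2
  have hfbar' := hfbar
  rw [Subfield.relfinrank_eq_finrank_of_le hAPRP] at hfbar'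
  haveI : Module.Finite AP (Subfield.extendScalars hAPRP) := Module.finite_of_finrank_pos hfbar'
  let bR := Module.finBasis AP (Subfield.extendScalars hAPRP)
  -- generators of `M̃_P` over `P̃(s)`-to-be: residues of `y` and the basis
  let ytil : Fin F → ResidueField V := fun i => residue V ⟨y i, hB.mem i⟩
  let gens : Finset (ResidueField V) := (Finset.univ.image ytil) ∪
    (Finset.univ.image fun i => ((bR i : Subfield.extendScalars hAPRP) : ResidueField V))
  -- a separating transcendence basis over finitely many `p`-power roots of constants
  obtain ⟨Cc, s, hCcP, hsCT, hind, hsep⟩ :=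
    exists_finset_separatingTranscendenceBasis k (ResidueField V) gens
  -- descent: constants are residues of elements of `P`
  have hdc : ∀ c ∈ Cc, ∃ b ∈ PSet k Ω, ∃ hb : b ∈ V, residue V ⟨b, hb⟩ = c := fun c hc =>
    exists_residue_eq_of_mem_perfectClosure V hk (hCcP hc)
  choose bc hbcP hbcV hbcres using hdc
  -- descent: basis vectors
  have hdb : ∀ i, ∃ C : Finset Ω, ↑C ⊆ PSet k Ω ∧
      ((bR i : Subfield.extendScalars hAPRP) : ResidueField V) ∈
        resField V (Mk k x y T (C : Set Ω)).toSubfield := by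
    intro i
    have hi : ((bR i : Subfield.extendScalars hAPRP) : ResidueField V) ∈ RP := (bR i).2
    obtain ⟨a, ha, hres⟩ := (mem_resField_iff V _ _).mp hi
    obtain ⟨C, hCP, haC⟩ := exists_finset_mem_Mk ha
    exact ⟨C, hCP, (mem_resField_iff V _ _).mpr ⟨a, haC, hres⟩⟩
  choose Cb hCbP hCbmem using hdb
  refine ⟨C₁ ∪ (Cc.attach.image fun c => bc c.1 c.2) ∪ Finset.univ.biUnion Cb, ?_,
    fun S hCS hSP => ?_⟩
  · intro c hc
    rcases Finset.mem_union.mp hc with hc | hc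
    · rcases Finset.mem_union.mp hc with hc | hc
      · exact hC₁P hc
      · obtain ⟨c', -, rfl⟩ := Finset.mem_image.mp hc
        exact hbcP c'.1 c'.2
    · obtain ⟨i, -, hc⟩ := Finset.mem_biUnion.mp hc
      exact hCbP i hc
  · have hC₁S : (C₁ : Set Ω) ⊆ S := fun c hc =>
      hCS (Finset.mem_union_left _ (Finset.mem_union_left _ hc))
    set St := resField V (lS k S).toSubfield with hSt
    set AS := resField V (Lk k x y S).toSubfield with hAS
    set RS := resField V (Mk k x y T S).toSubfield with hRS
    have hStRS : St ≤ RS := resField_mono V (lS_le_Mk (x := x) (y := y) (T := T) S)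
    have hASRS : AS ≤ RS := resField_mono V (Lk_le_Mk (T := T) S)
    -- the constants `Cc` are residues of `S`
    have hCcSt : (Cc : Set (ResidueField V)) ⊆ St := by
      intro c hc
      have hbS : bc c hc ∈ S := hCS (Finset.mem_union_left _ (Finset.mem_union_right _
        (Finset.mem_image.mpr ⟨⟨c, hc⟩, Finset.mem_attach _ _, rfl⟩)))
      have h := residue_mem_resField V (E := (lS k S).toSubfield) ⟨bc c hc, hbcV c hc⟩
        (subset_adjoin k S hbS)
      rwa [hbcres c hc] at h
    -- the generators are residues of `M_S`
    have hyRS : ∀ i, ytil i ∈ RS := fun i =>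
      residue_mem_resField V _ (Lk_le_Mk S (y_mem_Lk S i))
    have hbRS : ∀ i, ((bR i : Subfield.extendScalars hAPRP) : ResidueField V) ∈ RS := fun i =>
      resField_mono V (show (Mk k x y T (Cb i : Set Ω)).toSubfield ≤ (Mk k x y T S).toSubfield from
        fun a ha => Mk_mono (fun c hc => hCS (Finset.mem_union_right _
          (Finset.mem_biUnion.mpr ⟨i, Finset.mem_univ _, hc⟩))) ha) (hCbmem i)
    have hgensRS : (gens : Set (ResidueField V)) ⊆ RS := by
      intro g hg
      rcases Finset.mem_union.mp hg with hg | hg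
      · obtain ⟨i, -, rfl⟩ := Finset.mem_image.mp hg
        exact hyRS i
      · obtain ⟨i, -, rfl⟩ := Finset.mem_image.mp hg
        exact hbRS i
    -- `S̃` and `M̃_S` as intermediate fields over `k`
    have hkSt : ∀ c : k, algebraMap k (ResidueField V) c ∈ St := fun c =>
      residue_mem_resField V (algebraMap k V c) ((lS k S).algebraMap_mem c)
    let Kt : IntermediateField k (ResidueField V) := St.toIntermediateField hkSt
    have hKt : (Kt : Set (ResidueField V)) = St := rfl
    let RSt : IntermediateField k (ResidueField V) := RS.toIntermediateField fun c => hStRS (hkSt c)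
    have hRSt : (RSt : Set (ResidueField V)) = RS := rfl
    -- `s ⊆ M̃_S`
    have hsRS : (s : Set (ResidueField V)) ⊆ RS := by
      intro σ hσ
      have hle : adjoin k ((Cc : Set (ResidueField V)) ∪ ↑gens) ≤ RSt :=
        adjoin_le_iff.mpr (Set.union_subset (hCcSt.trans hStRS) hgensRS)
      exact hle (hsCT hσ)
    -- separability of the generators over `k(S̃, s)`
    set Base : IntermediateField k (ResidueField V) := adjoin k ((Kt : Set (ResidueField V)) ∪ ↑s)
      with hBase
    have hsepS : ∀ g ∈ gens, IsSeparable Base g := fun g hg =>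
      isSeparable_of_le (adjoin.mono k _ _ (Set.union_subset_union_left _ hCcSt)) (hsep g hg)
    -- the field `F⁰ = k(S̃, s, gens) ⊆ M̃_S`
    set F0 : IntermediateField k (ResidueField V) :=
      adjoin k ((Kt : Set (ResidueField V)) ∪ ↑s ∪ ↑gens) with hF0
    have hF0RS : F0 ≤ RSt :=
      adjoin_le_iff.mpr (Set.union_subset (Set.union_subset hStRS hsRS) hgensRS)
    have hF0RS' : F0.toSubfield ≤ RS := fun z hz => hF0RS hz
    have hASF0 : AS ≤ F0.toSubfield := by
      rw [hAS, hB.resField_Lk_eq hSP]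
      refine Subfield.closure_le.mpr ?_
      rintro r (hr | ⟨i, rfl⟩)
      · exact subset_adjoin k _ (Or.inl (Or.inl hr))
      · exact subset_adjoin k _ (Or.inr (Finset.mem_union_left _
          (Finset.mem_image.mpr ⟨i, Finset.mem_univ _, rfl⟩)))
    -- degrees: `f_S = f̄`, `[F⁰ : L̃_S] ≥ f̄`, hence `M̃_S = F⁰`
    have hfS : AS.relfinrank RS = AP.relfinrank RP := by
      rw [hAS, hRS, hAP, hRP, ← inertiaDegree_level_eq_relfinrank, ← inertiaDegree_level_eq_relfinrank]
      exact hC₁ S hC₁S hSP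
    have hfSpos : 0 < AS.relfinrank RS := by rw [hfS]; exact hfbar
    have htower := Subfield.relfinrank_mul_relfinrank hASF0 hF0RS'
    have hF0pos : 0 < AS.relfinrank F0.toSubfield := by
      rcases Nat.eq_zero_or_pos (AS.relfinrank F0.toSubfield) with h0 | h0
      · rw [h0, zero_mul] at htower
        rw [← htower] at hfSpos
        exact (lt_irrefl 0 hfSpos).elim
      · exact h0
    have hGF0 : (Set.range fun i => ((bR i : Subfield.extendScalars hAPRP) : ResidueField V)) ⊆
        F0.toSubfield := by
      rintro _ ⟨i, rfl⟩
      exact subset_adjoin k _ (Or.inr (Finset.mem_union_right _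
        (Finset.mem_image.mpr ⟨i, Finset.mem_univ _, rfl⟩)))
    have hle := relfinrank_le_relfinrank_of_span (resField_mono V (Lk_mono hSP)) hASF0
      (hF0RS'.trans (resField_mono V (Mk_mono hSP))) hAPRP hF0pos hGF0
      (fun z hz => mem_span_range_of_basis hAPRP bR hz)
    have hone : F0.toSubfield.relfinrank RS = 1 := by
      have h1 : AS.relfinrank F0.toSubfield * F0.toSubfield.relfinrank RS ≤
          AS.relfinrank F0.toSubfield * 1 := by
        rw [htower, mul_one, hfS]
        exact hle
      have h2 : F0.toSubfield.relfinrank RS ≤ 1 := Nat.le_of_mul_le_mul_left h1 hF0pos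
      have h3 : F0.toSubfield.relfinrank RS ≠ 0 := fun h0 => by
        rw [h0, mul_zero] at htower
        rw [← htower] at hfSpos
        exact lt_irrefl 0 hfSpos
      omega
    have hRSF0 : RS ≤ F0.toSubfield := Subfield.relfinrank_eq_one_iff.mp hone
    -- every element of `F⁰` is separable over `Base = k(S̃, s)`
    have hF0' : (adjoin Base (gens : Set (ResidueField V))).restrictScalars k = F0 := by
      rw [hF0, hBase, adjoin_adjoin_left]
    haveI : Algebra.IsSeparable Base (adjoin Base (gens : Set (ResidueField V))) :=
      (isSeparable_adjoin_iff_isSeparable Base _).mpr hsepS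
    have hsepF0 : ∀ z ∈ F0, IsSeparable Base z := by
      intro z hz
      have hz' : z ∈ adjoin Base (gens : Set (ResidueField V)) := by
        have h : z ∈ (adjoin Base (gens : Set (ResidueField V))).restrictScalars k := by
          rw [hF0']; exact hz
        exact h
      have h1 : IsSeparable Base (⟨z, hz'⟩ : adjoin Base (gens : Set (ResidueField V))) :=
        Algebra.IsSeparable.isSeparable _ _
      have hmin := minpoly.algebraMap_eq (A := Base)
        (algebraMap (adjoin Base (gens : Set (ResidueField V))) (ResidueField V)).injective
        (⟨z, hz'⟩ : adjoin Base (gens : Set (ResidueField V)))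
      have hzz : algebraMap (adjoin Base (gens : Set (ResidueField V))) (ResidueField V) ⟨z, hz'⟩ = z :=
        rfl
      rw [hzz] at hmin
      show (minpoly Base z).Separable
      rw [hmin]
      exact h1
    -- algebraic independence of `s` over `S̃`
    have hindk : AlgebraicIndependent k ((↑) : s → ResidueField V) :=
      AlgebraicIndependent.of_ringHom_of_comp_eq (algebraMap k (adjoin k (Cc : Set (ResidueField V))))
        (RingHom.id (ResidueField V)) hind (algebraMap k _).injective
        (by ext c; exact (IsScalarTower.algebraMap_apply k (adjoin k (Cc : Set (ResidueField V)))
          (ResidueField V) c).symm)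
    haveI : Algebra.IsAlgebraic k Kt := ⟨fun c =>
      IntermediateField.isAlgebraic_iff.mpr (isAlgebraic_resField_lS hk hSP c.2)⟩
    have hindKt : AlgebraicIndependent Kt ((↑) : s → ResidueField V) := hindk.extendScalars Kt
    refine ⟨s, hsRS, ?_, fun z hz => ?_⟩
    · exact hindKt
    · -- over `S̃(s)`: the base `Base = k(S̃, s)` is `S̃(s)` with scalars restricted
      have hsepz : IsSeparable Base z := hsepF0 z (hRSF0 hz)
      have hBase' : (adjoin Kt (s : Set (ResidueField V))).restrictScalars k = Base := by
        rw [hBase, restrictScalars_adjoin]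
      have hsepz' : IsSeparable ((adjoin Kt (s : Set (ResidueField V))).restrictScalars k) z := by
        rw [hBase']; exact hsepz
      exact hsepz'

end SepGen

/-! ### Assembly: Thm. 5.5.3 from the generalized stability theorem -/

section Assembly

/-- **Temkin 2013, Thm. 5.5.3, from the generalized stability theorem.** If
`Kuhlmann2010Stability` (Kuhlmann 2010, Thm. 1.1 over a trivially valued ground field;
`ValuationDefect.lean`) holds, then so does `Temkin2013_Thm553` (`AbhyankarToroidalCharts.lean`):
for a finitely generated extension `K/k` with a valuation ring `K° ⊇ k` of transcendence defect
`0`, there is a finite purely inseparable `l/k` such that for every finite purely inseparable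
`l' ⊇ l`, every compositum `K' = l'K` and every valuation ring of `K'` over `K°`, the residue field
of `K'` is separably generated over `l'`. PROVED: the levels of `AbhyankarConstantReduction.lean`
inside an algebraic closure `Ω ⊇ K` with an extension `V` of `K°`, the counting theorem
(`exists_inertiaDegree_level_eq`, where stability enters) and separable generation at large levels
(`exists_separablyGenerated_level`); `l := k(C)` for the finite set of constants `C ⊆ k^{1/p^∞}`
found there, and transport to the abstract `l'`, `K'`, `O'` (`l' → Ω` is unique, `K' → Ω` exists
over `K` and `O' = V ∩ K'` as `K'/K` is purely inseparable). The printed proof (p. 61) obtains the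
same statement from the same stability theorem through a tower of degree-`p` steps.
[cite: Temkin2013, Thm. 5.5.3 (p. 61 of arXiv:0804.1554v3)] -/
theorem Temkin2013_Thm553.of_stability (hKS : Kuhlmann2010Stability.{u}) : Temkin2013_Thm553.{u} := by
  intro k K _ _ _ hfg O hk hD
  classical
  -- ambient closure and an extension of the valuation ring (Chevalley)
  let Ω : Type u := AlgebraicClosure K
  obtain ⟨V, hV⟩ := exists_valuationSubring_comap_eq (Ω := Ω) O
  subst hV
  have hkV : ∀ c : k, algebraMap k Ω c ∈ V := fun c => by
    have h := hk c
    rwa [ValuationSubring.mem_comap, ← IsScalarTower.algebraMap_apply] at h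
  -- an Abhyankar basis of `K/k` (Remark 2.1.3)
  letI := algebraOfMem k (V.comap (algebraMap K Ω)) hk
  haveI := isScalarTower_algebraOfMem k (V.comap (algebraMap K Ω)) hk
  have hN : Algebra.trdeg k K < Cardinal.aleph0 := trdeg_lt_aleph0_of_fg hfg
  obtain ⟨N, hNn⟩ := Cardinal.lt_aleph0.mp hN
  obtain ⟨E, hE⟩ := Cardinal.lt_aleph0.mp (ratRank_lt_aleph0 (V.comap (algebraMap K Ω)) hk hN)
  obtain ⟨F, hF⟩ := Cardinal.lt_aleph0.mp (residueTrdeg_lt_aleph0 (V.comap (algebraMap K Ω)) hk hN)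
  have hsum : E + F = N := by
    have h := (transcendenceDefect_eq_zero_iff (V.comap (algebraMap K Ω)) hk hN).mp hD
    rw [hE, hF, hNn] at h
    exact_mod_cast h
  obtain ⟨yK, hyK⟩ :=
    exists_algebraicIndependent_residue_of_residueTrdeg_eq (V.comap (algebraMap K Ω)) hk F hF
  obtain ⟨xK, hxK0, hxK⟩ :=
    exists_linearIndependent_valuation_of_ratRank_eq (V.comap (algebraMap K Ω)) E hE
  have hBind : AlgebraicIndependent k (Sum.elim xK fun i => (yK i : K)) :=
    algebraicIndependent_sumElim_of_valuation _ yK hyK xK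
      (injective_valuation_prod_pow _ xK hxK0 hxK)
  have hcard : Cardinal.lift.{0} (Algebra.trdeg k K) ≤ Cardinal.lift.{u} (Cardinal.mk (Fin E ⊕ Fin F)) := by
    rw [hNn]
    simp only [Cardinal.mk_sum, Cardinal.mk_fin, Cardinal.lift_natCast, Cardinal.lift_add]
    exact_mod_cast hsum.ge
  have hBasis : IsTranscendenceBasis k (Sum.elim xK fun i => (yK i : K)) :=
    hBind.isTranscendenceBasis_of_lift_trdeg_le_of_finite hcard
  haveI hfinK := finiteDimensional_adjoin_of_isTranscendenceBasis hfg _ hBasis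
  -- the ambient Abhyankar system
  let x : Fin E → Ω := fun j => algebraMap K Ω (xK j)
  let y : Fin F → Ω := fun i => algebraMap K Ω (yK i : K)
  have hx0 : ∀ j, x j ≠ 0 := fun j => (map_ne_zero _).mpr (hxK0 j)
  have hymem : ∀ i, y i ∈ V := fun i => (yK i).2
  have hB : IsAmbientAbhyankarSystem V hkV x y := by
    refine { ne_zero := hx0, mem := hymem, linearIndependent := ?_, algebraicIndependent := ?_ }
    · rw [linearIndependent_valuation_iff V x hx0]
      rw [linearIndependent_valuation_iff _ xK hxK0] at hxK
      intro s g hg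
      refine hxK s g ?_
      rw [valuation_comap_eq_one_iff V]
      have hcoe : algebraMap K Ω (∏ j ∈ s, xK j ^ g j) = ∏ j ∈ s, x j ^ g j := by
        rw [map_prod]
        exact Finset.prod_congr rfl fun j _ => map_zpow₀ _ _ _
      rw [hcoe]
      exact hg
    · letI := algebraOfMem k V hkV
      have h := AlgebraicIndependent.ringHom_of_comp_eq (RingHom.id k)
        (residueFieldHom K V) hyK Function.surjective_id (residueFieldHom K V).injective (by
          ext c
          change residueFieldHom K V (residue _ (algebraMap k (V.comap (algebraMap K Ω)) c)) =
            residue V (algebraMap k V c)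
          rw [residueFieldHom_residue]
          congr 1)
      convert h using 1
      funext i
      simp only [Function.comp_apply]
      rw [residueFieldHom_residue]
      rfl
  -- generators of `K/k`
  obtain ⟨gK, hgK⟩ := hfg
  let T : Finset Ω := gK.image (algebraMap K Ω)
  -- the image of `K` is `k(T)` and contains `B`
  have hKT : ∀ a : K, algebraMap K Ω a ∈ adjoin k (T : Set Ω) := by
    intro a
    have ha : a ∈ adjoin k (gK : Set K) := by rw [hgK]; exact mem_top
    have ha' : (IsScalarTower.toAlgHom k K Ω) a ∈ (adjoin k (gK : Set K)).map
        (IsScalarTower.toAlgHom k K Ω) := ⟨a, ha, rfl⟩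
    rw [adjoin_map] at ha'
    have himg : (IsScalarTower.toAlgHom k K Ω) '' (gK : Set K) = (T : Set Ω) := by
      simp only [T, Finset.coe_image]; rfl
    rw [himg] at ha'
    exact ha'
  have hT : ∀ t ∈ T, IsIntegral (levL k x y (∅ : Set Ω)) t := by
    intro t ht
    obtain ⟨g, -, rfl⟩ := Finset.mem_image.mp ht
    rw [isIntegral_levL_iff]
    have hg : IsIntegral (adjoin k (Set.range (Sum.elim xK fun i => (yK i : K)))) g :=
      Algebra.IsIntegral.isIntegral g
    have hmem : ∀ a : adjoin k (Set.range (Sum.elim xK fun i => (yK i : K))),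
        algebraMap K Ω (a : K) ∈ Lk k x y (∅ : Set Ω) := by
      intro a
      have ha' : (IsScalarTower.toAlgHom k K Ω) (a : K) ∈
          (adjoin k (Set.range (Sum.elim xK fun i => (yK i : K)))).map
            (IsScalarTower.toAlgHom k K Ω) := ⟨a, a.2, rfl⟩
      rw [adjoin_map] at ha'
      refine adjoin.mono k _ _ ?_ ha'
      rintro _ ⟨_, ⟨(j | i), rfl⟩, rfl⟩
      · exact Or.inr (Or.inr ⟨j, rfl⟩)
      · exact Or.inr (Or.inl ⟨i, rfl⟩)
    let ρ : adjoin k (Set.range (Sum.elim xK fun i => (yK i : K))) →+* Lk k x y (∅ : Set Ω) :=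
      RingHom.codRestrict ((algebraMap K Ω).comp (algebraMap _ K)) (Lk k x y (∅ : Set Ω)) hmem
    exact hg.map_of_comp_eq ρ (algebraMap K Ω) (RingHom.ext fun a => rfl)
  -- separable generation at large levels
  obtain ⟨C, hCP, hC⟩ := exists_separablyGenerated_level (T := T) hKS hB hT
  -- the field `l = k(C)`
  obtain ⟨q, hq⟩ := ExpChar.exists k
  have hCint : ∀ c ∈ (C : Set Ω), IsIntegral k c := fun c hc =>
    (isAlgebraic_of_mem_perfectClosure (hCP hc)).isIntegral
  haveI hlpi : IsPurelyInseparable k (adjoin k (C : Set Ω)) :=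
    (isPurelyInseparable_adjoin_iff_pow_mem k Ω q).mpr fun c hc =>
      (mem_perfectClosure_iff_pow_mem q).mp (hCP hc)
  refine ⟨adjoin k (C : Set Ω), inferInstance, inferInstance, finiteDimensional_adjoin hCint, hlpi, ?_⟩
  intro l' _ _ _ _ hfin' hpi' K' _ _ _ _ _ _ hgen O' hO' hl'
  haveI := hpi'
  -- `l' → Ω`, unique, extending `l = k(C) ⊆ Ω`
  let ψ : l' →ₐ[k] Ω := IsAlgClosed.lift
  set S₀ : Set Ω := Set.range ψ with hS₀
  have hS₀P : S₀ ⊆ PSet k Ω := by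
    rintro _ ⟨c, rfl⟩
    obtain ⟨n, a, ha⟩ := IsPurelyInseparable.pow_mem k q c
    exact (mem_perfectClosure_iff_pow_mem q).mpr ⟨n, a, by rw [← map_pow, ← ha, AlgHom.commutes]⟩
  have hψl : ∀ c : adjoin k (C : Set Ω), ψ (algebraMap _ l' c) = (c : Ω) := by
    intro c
    have h := Subsingleton.elim (ψ.comp (IsScalarTower.toAlgHom k (adjoin k (C : Set Ω)) l'))
      (IsScalarTower.toAlgHom k (adjoin k (C : Set Ω)) Ω)
    exact congrArg (fun f : adjoin k (C : Set Ω) →ₐ[k] Ω => f c) h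
  have hCS₀ : (C : Set Ω) ⊆ S₀ := fun c hc =>
    ⟨algebraMap _ l' (⟨c, subset_adjoin k _ hc⟩ : adjoin k (C : Set Ω)), hψl _⟩
  obtain ⟨s, hsRS, hind, hsep⟩ := hC S₀ hCS₀ hS₀P
  -- `K'/K` is purely inseparable (`K' = K[l']`), in particular algebraic; `K' → Ω` over `K`
  haveI : ExpChar K q := expChar_of_injective_algebraMap (algebraMap k K).injective q
  haveI : ExpChar K' q := expChar_of_injective_algebraMap (algebraMap K K').injective q
  haveI : IsPurelyInseparable K K' :=
    (isPurelyInseparable_iff_pow_mem K q).mpr (exists_pow_mem_range_of_adjoin_eq_top (κ := k) q hgen)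
  let φ : K' →ₐ[K] Ω := IsAlgClosed.lift
  have hφψ : ∀ c : l', φ (algebraMap l' K' c) = ψ c := by
    intro c
    have h := Subsingleton.elim ((φ.restrictScalars k).comp (IsScalarTower.toAlgHom k l' K')) ψ
    exact congrArg (fun f : l' →ₐ[k] Ω => f c) h
  -- `O' = V ∩ K'` (purely inseparable uniqueness)
  letI iK'Ω : Algebra K' Ω := (φ : K' →+* Ω).toAlgebra
  have hφalg : ∀ z : K', algebraMap K' Ω z = φ z := fun _ => rfl
  have hO'V : O' = V.comap (algebraMap K' Ω) := by
    ext z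
    obtain ⟨n, c, hc⟩ := IsPurelyInseparable.pow_mem K q z
    rw [mem_valuationSubring_iff_pow_mem O' z (expChar_pow_pos K' q n).ne',
      mem_valuationSubring_iff_pow_mem _ z (expChar_pow_pos K' q n).ne', ← hc,
      ValuationSubring.mem_comap, hφalg, AlgHom.commutes]
    have h1 : algebraMap K K' c ∈ O' ↔ c ∈ O'.comap (algebraMap K K') := Iff.rfl
    rw [h1, hO']
    rfl
  subst hO'V
  -- residue fields: `K̃' → Ṽ`, with image the residue field of `M_{S₀}`
  set θ := residueFieldHom K' V with hθ
  have hrange : (algebraMap K' Ω).fieldRange = (Mk k x y T S₀).toSubfield := by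
    apply le_antisymm
    · rintro _ ⟨w, rfl⟩
      rw [hφalg]
      have hw : w ∈ Algebra.adjoin K (Set.range (algebraMap l' K')) := by rw [hgen]; trivial
      refine Algebra.adjoin_induction ?_ ?_ ?_ ?_ hw
      · rintro _ ⟨c, rfl⟩
        rw [hφψ]
        exact subset_adjoin k _ (Or.inl (Or.inl ⟨c, rfl⟩))
      · intro r
        rw [AlgHom.commutes]
        exact adjoin.mono k _ _ (fun t ht => Or.inr ht) (hKT r)
      · intro a b _ _ ha hb
        rw [map_add]
        exact add_mem ha hb
      · intro a b _ _ ha hb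
        rw [map_mul]
        exact mul_mem ha hb
    · have hle : Mk k x y T S₀ ≤ (φ.restrictScalars k).fieldRange := by
        refine adjoin_le_iff.mpr ?_
        rintro t ((⟨c, rfl⟩ | ht) | ht)
        · exact ⟨algebraMap l' K' c, hφψ c⟩
        · rcases ht with ⟨i, rfl⟩ | ⟨j, rfl⟩
          · exact ⟨algebraMap K K' (yK i : K), φ.commutes _⟩
          · exact ⟨algebraMap K K' (xK j), φ.commutes _⟩
        · obtain ⟨g, -, rfl⟩ := Finset.mem_image.mp ht
          exact ⟨algebraMap K K' g, φ.commutes _⟩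
      intro t ht
      obtain ⟨w, hw⟩ := hle ht
      exact ⟨w, hw⟩
  have hθrange : θ.fieldRange = resField V (Mk k x y T S₀).toSubfield := by
    rw [hθ, fieldRange_residueFieldHom, residueSubfield_eq_resField, hrange]
  -- the constants: `S̃ = residues of ψ(l')`, `k(S₀) = S₀`
  have hadjS₀ : (lS k S₀ : Set Ω) = S₀ := by
    apply le_antisymm
    · have : lS k S₀ ≤ ψ.fieldRange := adjoin_le_iff.mpr (by rintro _ ⟨c, rfl⟩; exact ⟨c, rfl⟩)
      intro a ha
      obtain ⟨c, hc⟩ := this ha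
      exact ⟨c, hc⟩
    · exact subset_adjoin k S₀
  letI il' := algebraOfMem l' (V.comap (algebraMap K' Ω)) hl'
  have hψV : ∀ c : l', ψ c ∈ V := fun c => by
    have h := hl' c
    rw [ValuationSubring.mem_comap, hφalg, hφψ] at h
    exact h
  have hθl' : ∀ c : l', θ (algebraMap l' _ c) = residue V ⟨ψ c, hψV c⟩ := by
    intro c
    change θ (residue _ (algebraMap l' (V.comap (algebraMap K' Ω)) c)) = _
    rw [hθ, residueFieldHom_residue]
    congr 1
    exact Subtype.ext (hφψ c)
  set St := resField V (lS k S₀).toSubfield with hSt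
  have hStrange : (St : Set (ResidueField V)) = Set.range fun c : l' => residue V ⟨ψ c, hψV c⟩ := by
    ext r
    rw [SetLike.mem_coe, mem_resField_iff]
    constructor
    · rintro ⟨a, ha, rfl⟩
      have ha' : (a : Ω) ∈ S₀ := by rw [← hadjS₀]; exact ha
      obtain ⟨c, hc⟩ := ha'
      exact ⟨c, congrArg (residue V) (Subtype.ext hc)⟩
    · rintro ⟨c, rfl⟩
      exact ⟨⟨ψ c, hψV c⟩, subset_adjoin k S₀ ⟨c, rfl⟩, rfl⟩
  -- the separating transcendence basis, pulled back to `K̃'`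
  have hsθ : (s : Set (ResidueField V)) ⊆ Set.range θ := fun σ hσ => by
    have h : σ ∈ θ.fieldRange := by rw [hθrange]; exact hsRS hσ
    exact h
  let s' : Finset (ResidueField (V.comap (algebraMap K' Ω))) := s.preimage θ θ.injective.injOn
  have hs's : θ '' (s' : Set _) = s := by
    rw [Finset.coe_preimage, Set.image_preimage_eq_of_subset hsθ]
  -- the ring hom `l' → S̃` compatible with `θ`
  have hθl'St : ∀ c : l', θ (algebraMap l' _ c) ∈ St := fun c => by
    rw [hθl']
    have h : residue V ⟨ψ c, hψV c⟩ ∈ (St : Set (ResidueField V)) := by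
      rw [hStrange]; exact ⟨c, rfl⟩
    exact h
  let f₁ : l' →+* St := RingHom.codRestrict (θ.comp (algebraMap l' _)) St hθl'St
  have hf₁ : (algebraMap St (ResidueField V)).comp f₁ = θ.comp (algebraMap l' _) :=
    RingHom.ext fun _ => rfl
  -- algebraic independence of `s'` over `l'`
  have hind' : AlgebraicIndependent l'
      ((↑) : s' → ResidueField (V.comap (algebraMap K' Ω))) := by
    refine AlgebraicIndependent.of_ringHom_of_comp_eq f₁ θ ?_ f₁.injective hf₁
    let σ : s' → s := fun w => ⟨θ w, Finset.mem_preimage.mp w.2⟩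
    have hσ : Function.Injective σ := fun a b hab =>
      Subtype.ext (θ.injective (congrArg Subtype.val hab))
    exact hind.comp σ hσ
  -- the fields `l'(s') ⊆ K̃'` and `S̃(s) ⊆ Ṽ` correspond under `θ`
  let F₂ : IntermediateField l' (ResidueField (V.comap (algebraMap K' Ω))) :=
    IntermediateField.adjoin l' (s' : Set (ResidueField (V.comap (algebraMap K' Ω))))
  let F₁ : IntermediateField St (ResidueField V) :=
    IntermediateField.adjoin St (s : Set (ResidueField V))
  have hmapF : (F₂.toSubfield).map θ = F₁.toSubfield := by
    change (IntermediateField.adjoin l' (s' : Set (ResidueField (V.comap (algebraMap K' Ω))))).toSubfield.map θ =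
      (IntermediateField.adjoin St (s : Set (ResidueField V))).toSubfield
    rw [IntermediateField.adjoin_toSubfield, IntermediateField.adjoin_toSubfield,
      RingHom.map_field_closure, Set.image_union, ← Set.range_comp, hs's]
    congr 2
    rw [show Set.range (algebraMap (↥St) (ResidueField V)) = (St : Set (ResidueField V)) from
      Subtype.range_coe, hStrange]
    exact congrArg Set.range (funext hθl')
  have hmemF₁ : ∀ c : F₂, θ (c : ResidueField (V.comap (algebraMap K' Ω))) ∈ F₁ := fun c => by
    have h : θ c ∈ (F₂.toSubfield).map θ := Subfield.mem_map.mpr ⟨c, c.2, rfl⟩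
    rw [hmapF] at h
    exact h
  let hF : F₂ →+* F₁ := RingHom.codRestrict (θ.comp (algebraMap F₂ _)) F₁ hmemF₁
  have hFbij : Function.Bijective hF := by
    refine ⟨hF.injective, fun d => ?_⟩
    have hd : (d : ResidueField V) ∈ (F₂.toSubfield).map θ := by rw [hmapF]; exact d.2
    obtain ⟨c, hc, hcd⟩ := Subfield.mem_map.mp hd
    exact ⟨⟨c, hc⟩, Subtype.ext hcd⟩
  let e : F₂ ≃+* F₁ := RingEquiv.ofBijective hF hFbij
  -- `Ṽ` as an algebra over `l'(s')` through `θ`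
  letI iF₂R : Algebra F₂ (ResidueField V) := (θ.comp (algebraMap F₂ _)).toAlgebra
  let θA : ResidueField (V.comap (algebraMap K' Ω)) →ₐ[F₂] ResidueField V :=
    { θ with commutes' := fun _ => rfl }
  have hcomp : (algebraMap F₂ (ResidueField V)).comp (e.symm : F₁ →+* F₂) =
      algebraMap F₁ (ResidueField V) := by
    ext d
    change ((hF (e.symm d) : F₁) : ResidueField V) = (d : ResidueField V)
    rw [show hF (e.symm d) = e (e.symm d) from rfl, e.apply_symm_apply]
  -- every element of `K̃'` is separable over `l'(s')`
  have hsepAll : ∀ z : ResidueField (V.comap (algebraMap K' Ω)), IsSeparable F₂ z := by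
    intro z
    have hz : θ z ∈ resField V (Mk k x y T S₀).toSubfield := by
      rw [← hθrange]; exact ⟨z, rfl⟩
    have h1 : IsSeparable F₁ (θ z) := hsep _ hz
    have h2 : IsSeparable F₂ (θA z) := isSeparable_of_ringHom_comp_eq (e.symm : F₁ →+* F₂) hcomp h1
    exact IsSeparable.of_algHom θA h2
  -- conclusion
  have halg : Algebra.IsAlgebraic (IntermediateField.adjoin l'
      (Set.range ((↑) : s' → ResidueField (V.comap (algebraMap K' Ω)))))
      (ResidueField (V.comap (algebraMap K' Ω))) := by
    rw [Subtype.range_coe_subtype, Finset.setOf_mem]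
    exact ⟨fun z => (hsepAll z).isIntegral.isAlgebraic⟩
  exact ⟨s', isTranscendenceBasis_iff_algebraicIndependent_isAlgebraic.mpr
    ⟨hind', IntermediateField.isAlgebraic_adjoin_iff_top.mp halg⟩, hsepAll⟩

end Assembly

end Literature.AlgebraicGeometry.Resolution

end
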